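import Summits.ResolutionOfSingularities.ResolutionOfSingularities.Theorems.WildConesCampaignW46HypersurfacesCharTwoHilbertWitness
import Summits.ResolutionOfSingularities.ResolutionOfSingularities.Theorems.WildConesCampaignW46HypersurfacesCharTwoNearPointExists

/-!
# [OURS · L1 W4.6, rung (ii) at p = 2, EVERY dimension n, EVERY field] THE MILNOR GAP: an isolated double point
# `z² = a(u₁,…,uₙ)` in characteristic 2 never has `μ = 3` — `μ ∈ {1, 2} ∪ [4, ∞)` — and `μ ≤ 2` means: resolved by
# ONE point blow-up, over every field

HONEST FRAMING. Everything here is OURS: theorems about route WildCones' own TYPED point-blow-up dynamics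
(`Theorems/WildConesClassicalRegimesDefs.lean`) and the seat's invariants `milnorEmbDim` (p498937), `milnorHilbertTwo`
(p511581). NOTHING here is a statement of the manuscript [Hironaka2017]; no FACT-LIST premise; AI review is weaker than
expert review. Cell res-hironaka (LADDER-RESOLUTION rung L, D-0089), slot W4.6, seat res-L1-s46-pv-4 (gen 7); host route
`WildCones`, crux `ClassicalRegimes` (stmt-ResolutionOfSingularities-16884; proved).

THE GAP. By corank: `e = 0 ⟺ μ = 1` (gen 3); `e = 1 ⟹ μ` EVEN `≥ 2` (the Milnor algebra is `κ[X]/(X^μ)` with `μ` even,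
p501431); `e ≥ 2 ⟹ μ ≥ h₂ + e + 1 ≥ 4` (p517132). Hence `μ = 3` NEVER occurs, `μ = 2 ⟹ e = 1`, and `μ ≤ 2` singles out
exactly the states resolved by one point blow-up over a separably closed field (gen 7, `…SepClosed`); the implication
«`μ ≤ 2 ⟹` no infinitely-near double point» holds over EVERY field (this file), its converse needs the separable
closedness (`…FourfoldRationalCubic`: `μ = 4`, no rational near point over `𝔽₂`).

WHAT IS PROVED (every `n`, EVERY field of characteristic `2`; `n ≥ 3` where marked):

* `hypersurface_mu_trichotomy` — isolated double state: (`μ = 1` and `e = 0`) or (`μ = 2` and `e = 1`) or `μ ≥ 4`;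
  `hypersurface_mu_ne_three` — **`μ ≠ 3`**;
* `hypersurface_resolved_in_one_of_mu_le_two` — `n ≥ 3`, isolated, `μ ≤ 2` ⇒ NO chart/translation gives a double
  successor; `hypersurface_four_le_mu_of_exists_double_successor` — `n ≥ 3`: an isolated double point WITH an
  infinitely-near double point has `μ ≥ 4`.

References: [GreuelPfister2026] (context); [Hironaka2017] Th. 16.6 p.84 — role replaced only, under adjudication;
nothing of it is used.
-/

noncomputable section

-- single-problem summit: the doubled namespace component `ResolutionOfSingularities` is forced
set_option linter.dupNamespace false

open scoped BigOperators Classical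

open MvPowerSeries IsLocalRing

open Literature.AlgebraicGeometry.Resolution

namespace Summit.ResolutionOfSingularities.ResolutionOfSingularities.Theorems

namespace CampaignW46.HypersurfacesCharTwo

open WildCones WildCones.MuDropCharTwoOrdP ThreefoldsCharTwo

variable {κ : Type} [Field κ] {n : ℕ}

/-- [OURS · L1 W4.6 rung (ii) at `p = 2`, EVERY dimension, EVERY field of characteristic `2`; NOT a statement of the
manuscript] **THE MILNOR TRICHOTOMY** of an isolated double state of `z² = a(u₁,…,uₙ)`: EITHER `μ = 1` and `e = 0`, OR
`μ = 2` and `e = 1`, OR `μ ≥ 4` (`e = 0 ⟺ μ = 1`; `e = 1 ⟹ μ` even `≥ 2`; `e ≥ 2 ⟹ μ ≥ h₂ + e + 1 ≥ 4`). [folklore] -/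
theorem hypersurface_mu_trichotomy [CharP κ 2] (c : (Fin n → ℕ) → κ) (hM : MultP 2 n κ c) (hI : Isol 2 n κ c) :
    (mu 2 n κ c = 1 ∧ milnorEmbDim 2 n κ c = 0) ∨ (mu 2 n κ c = 2 ∧ milnorEmbDim 2 n κ c = 1) ∨ 4 ≤ mu 2 n κ c := by
  have hμ := milnorHilbertTwo_add_le_mu hM hI
  rcases Nat.lt_or_ge (milnorEmbDim 2 n κ c) 2 with hlt | hge
  · rcases Nat.lt_or_ge (milnorEmbDim 2 n κ c) 1 with h0 | h1
    · have he0 : milnorEmbDim 2 n κ c = 0 := by omega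
      exact Or.inl ⟨((milnorEmbDim_eq_zero_iff hM).mp he0).2, he0⟩
    · have he1 : milnorEmbDim 2 n κ c = 1 := by omega
      obtain ⟨⟨k, hk⟩, h2, -⟩ := curvilinear_of_milnorEmbDim_eq_one hM hI he1
      rcases Nat.lt_or_ge (mu 2 n κ c) 4 with hlt4 | hge4
      · exact Or.inr (Or.inl ⟨by omega, he1⟩)
      · exact Or.inr (Or.inr hge4)
  · rcases Nat.lt_or_ge (milnorEmbDim 2 n κ c) 3 with hlt3 | hge3
    · have he2 : milnorEmbDim 2 n κ c = 2 := by omega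
      have hr := (milnorHilbertTwo_range hM he2).1
      exact Or.inr (Or.inr (by omega))
    · exact Or.inr (Or.inr (by omega))

/-- [OURS · L1 W4.6 rung (ii) at `p = 2`, EVERY dimension, EVERY field of characteristic `2`; NOT a statement of the
manuscript] **THE MILNOR GAP: `μ ≠ 3`** for an isolated double state of `z² = a(u₁,…,uₙ)` — the Milnor number of an
isolated characteristic-two double point is `1`, `2`, or at least `4`. [folklore] -/
theorem hypersurface_mu_ne_three [CharP κ 2] (c : (Fin n → ℕ) → κ) (hM : MultP 2 n κ c) (hI : Isol 2 n κ c) :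
    mu 2 n κ c ≠ 3 := by
  rcases hypersurface_mu_trichotomy c hM hI with ⟨h1, -⟩ | ⟨h2, -⟩ | h4 <;> omega

/-- [OURS · L1 W4.6 rung (ii) at `p = 2`, every dimension `n ≥ 3`, EVERY field of characteristic `2`; NOT a statement
of the manuscript] **`μ ≤ 2` ⇒ RESOLVED BY ONE POINT BLOW-UP**: an isolated double state of `z² = a(u₁,…,uₙ)`, `n ≥ 3`,
with `μ ≤ 2` has NO chart and translation with a double successor (`μ = 1`: `e = 0`, gen 3; `μ = 2`: `e = 1` and
p505045). Over every field; the converse holds over separably closed fields (gen 7, `…SepClosed`) and fails over `𝔽₂`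
(`…FourfoldRationalCubic`). [folklore] -/
theorem hypersurface_resolved_in_one_of_mu_le_two [CharP κ 2] (hn : 3 ≤ n) (c : (Fin n → ℕ) → κ)
    (hM : MultP 2 n κ c) (hI : Isol 2 n κ c) (hμ : mu 2 n κ c ≤ 2) (i : Fin n) (τ : Fin n → κ) :
    ¬ MultP 2 n κ (step 2 n κ i τ c) := by
  rcases hypersurface_mu_trichotomy c hM hI with ⟨-, he0⟩ | ⟨h2, he1⟩ | h4
  · exact hypersurface_not_multP_step_of_milnorEmbDim_eq_zero c hM he0 i τ
  · exact (hypersurface_resolved_in_one_iff_mu_eq_two hn c hM hI he1).mpr h2 i τ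
  · omega

/-- [OURS · L1 W4.6 rung (ii) at `p = 2`, every dimension `n ≥ 3`, EVERY field of characteristic `2`; NOT a statement
of the manuscript] **AN INFINITELY-NEAR DOUBLE POINT FORCES `μ ≥ 4`**: if an isolated double state of `z² = a(u₁,…,uₙ)`,
`n ≥ 3`, has a chart and translation with a double successor, then `μ(c) ≥ 4`. [folklore] -/
theorem hypersurface_four_le_mu_of_exists_double_successor [CharP κ 2] (hn : 3 ≤ n) (c : (Fin n → ℕ) → κ)
    (hM : MultP 2 n κ c) (hI : Isol 2 n κ c) (h : ∃ (i : Fin n) (τ : Fin n → κ), MultP 2 n κ (step 2 n κ i τ c)) :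
    4 ≤ mu 2 n κ c := by
  obtain ⟨i, τ, hiτ⟩ := h
  rcases hypersurface_mu_trichotomy c hM hI with ⟨h1, -⟩ | ⟨h2, -⟩ | h4
  · exact absurd hiτ (hypersurface_resolved_in_one_of_mu_le_two hn c hM hI (by omega) i τ)
  · exact absurd hiτ (hypersurface_resolved_in_one_of_mu_le_two hn c hM hI (by omega) i τ)
  · exact h4

end CampaignW46.HypersurfacesCharTwo

end Summit.ResolutionOfSingularities.ResolutionOfSingularities.Theorems

end
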